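import Mathlib
import HarnessLib
import HarnessLib.Audit
import Summits.Langlands.Langlands.Theorems.OddPrimeDoorSplit
import Literature.NumberTheory.Automorphic.TotallyRealModularityBoxImages

/-!
# RealCyclotomicDoorSplit (Prelude: §1–§3 — Box shapes, CORE′, sectors, cells) — lens-5 g31 node on CORE = `OddPrimeDoorSplit.CoreResidual`

Cell `decomp-langlands`, lens 5 («finite/base range + asymptotic regime + bridge») in RESIDUAL MODE on the
lineage REST (stmt-Langlands-26998) → REST_E → LJR → RES → (F2T ∧ R₂⁻ ∧ R_ss⁻ ∧ R_cm⁶) → CORE, where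
CORE = `Summit.Langlands.Langlands.Theorems.OddPrimeDoorSplit.CoreResidual` (g30, tree) is the set of integral
`E` (`Δ ≠ 0`) over an unanchored totally real `K₀` of degree `≥ 6`, `[ℚ(j):ℚ]` in the residual range, off the
Allen locus and off the three odd-prime doors of g30 (`OffDoors`: not FLS-generic at 3, 5, 7; not on the
Skinner–Wiles locus; not on the Pan–Zhang locus).

## The dial (a property of the FIELD `K₀`): `K₀ ∩ ℚ(ζ_p)⁺` for `p = 5, 7`

* `p = 5`: `ℚ(ζ₅)⁺ = ℚ(√5)`; "`K₀ ∩ ℚ(ζ₅) = ℚ`" ⟺ `√5 ∉ K₀` ⟺ `¬ IsSquare (5 : K₀)`.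
* `p = 7`: `ℚ(ζ₇)⁺ = ℚ(ζ₇ + ζ₇⁻¹)`, cubic; "`K₀ ∩ ℚ(ζ₇) = ℚ`" ⟺ `X³ + X² − 2X − 1` has no root in `K₀`.

## The doors it opens (PRINT, vendored in the tree as ONE named fact, closed BY NAME — no junction)

BOX13 = `Literature.NumberTheory.Automorphic.Box2022_theorem1_3` (Box 2022, Thm. 1.3; file
`Literature/NumberTheory/Automorphic/TotallyRealModularityBoxImages.lean`): a NON-modular `E` over a totally
real `K` has (i) a framing of `E[3]` in `B(3)` or `C_s⁺(3)`; (ii) if `√5 ∉ K`, a framing of `E[5]` in `B(5)`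
(= Thorne 2016, Thm. 7.6: residually dihedral automorphy lifting, induction from the REAL quadratic subfield
`K(√5)` of `K(ζ₅)`); (iii) if `K ∩ ℚ(ζ₇) = ℚ`, a framing of `E[7]` in `B(7)` or `G(e7) ⊂ C_ns⁺(7)` (index 2)
(= Kalyanswamy 2018, Thm. 1.2 + FLS 2015, Thm. 4 / Prop. 9.1 (c)).  In the tree BOX13 is moreover REDUCED to
its printed lifting inputs (`Box2022_theorem1_3_of_fourLiftingTheorems`): modulo the g30 binder
`FLS2015_theorems3_4` it costs exactly Kalyanswamy 2018 Thm. 1.2 (`Kalyanswamy2018_theorem1_2`) and Thorne 2016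
Thm. 7.5 for `ρ_{E,p}` (= the body of `Thorne2016_theorem7_5_ellipticCurve`) — `box13_of_liftingFacts` below.
Before this node no cell node and no degree-`≥ 6` statement consumed BOX13
(tree consumers: the quartic route `SqrtFiveQuarticCovers`; clause (i) in `ThreeTorsionCollapse`).

## The cut

* T5 (THORNE SECTOR, CLOSED BY NAME): `√5 ∉ K₀` and NO Borel framing of `E[5]` ⇒ modular (`thorneFiveSector_of_box13`).
* K7 (KALYANSWAMY SECTOR, CLOSED BY NAME): `ℚ(ζ₇)⁺ ⊄ K₀` and NO framing of `E[7]` in `B(7) ∪ G(e7)` ⇒ modular.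
* C3 (CLOSED from the g30 binder FLS34 alone): no framing of `E[3]` in `B(3) ∪ C_s⁺(3)` ⇒ modular.
* CORE′ = `RefinedCore` (DECLARED RESIDUAL, IDEA-NEEDED): CORE ∩ `BoxShape` (the verbatim conclusion of BOX13).
  KERNEL: `core_of_refined : BOX13 → CORE′ → CORE`; NECESSITY `refined_of_core`; EXACTNESS `core_iff_refined`.
* CELLS of CORE′ by the dial (EXACT, `refined_iff_cells`): CELL D (`DisjointFieldCell`: `√5 ∉ K₀` and
  `ℚ(ζ₇)⁺ ⊄ K₀` — the residual curve carries a `K₀`-rational `5`-isogeny AND a `B(3)`/`C_s⁺(3)` structure AND a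
  `B(7)`/`G(e7)` structure) and CELL T (`EntangledFieldCell`: `√5 ∈ K₀` or `ℚ(ζ₇)⁺ ⊆ K₀`, hence `2 ∣ [K₀:ℚ]` or
  `3 ∣ [K₀:ℚ]` — `two_dvd_or_three_dvd_of_entangled`; every `K₀` of degree prime to `6` lies in CELL D).
* FINITE RANGE of CELL D (EXACT, `disjointFieldCell_iff_levelCells`): the four level cells
  `(b3,b5,b7) = X₀(105)`, `(s3,b5,b7)`, `(b3,b5,e7)`, `(s3,b5,e7)` — 4 of the 27 FLS level curves survive.

Compositions BY NAME up to RES / LJR / REST_E / REST through the tree's `OddPrimeDoorSplit.residual_of_core`,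
`largeJResidual_of_core`, `restE_of_core`, `closes_target` (`closes_target`, `closes_byName`; with
`box13_of_liftingFacts` the print inputs beyond g30's are exactly the two lifting theorems).  No `sorry`, no new
axiom, no `instance`, no `notation`; nothing here is a route's `closes`.
-/

set_option linter.dupNamespace false
set_option linter.unusedVariables false

open scoped NumberField IntermediateField MatrixGroups Polynomial
open NumberField IsDedekindDomain Field Polynomial Literature.NumberTheory.Automorphic
open Literature.NumberTheory.GaloisRepresentations
open Summit.Langlands.Langlands.Theorems.DepthIsolationSplit (UnanchoredBox UnanchoredHighDegreeModularE
  IntegralModelTransferPointwise SatakeAvatarTwo satakeAvatarTwo_of_host)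
open Summit.Langlands.Langlands.Theorems.JDegreeFilterSplit (jInv jDeg InResidualRange LargeJResidual
  RatBaseChangeModularity SmallFieldBaseChange largeJResidual_of_restE)
open Summit.Langlands.Langlands.Theorems.DyadicDoorSplit (AllenLocus AllenDyadicCorollary DyadicDegenerateResidual
  residual_of_largeJResidual)
open Summit.Langlands.Langlands.Theorems.OddPrimeDoorSplit (Generic357 OnSWDoor OnPZDoor OffDoors CoreResidual
  SkinnerWilesDihedralDoor PanZhangSupersingularDoor residual_of_core core_of_residual largeJResidual_of_core
  restE_of_core core_of_largeJResidual core_of_restE)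

namespace Summit.Langlands.Langlands.Theorems.RealCyclotomicDoorSplit

/-! ## §1 The residual image shapes of Box 2022, Thm. 1.3 (verbatim clauses of `Box2022_theorem1_3`) -/

/-- BOREL SHAPE at level `p`: some framing `ρ̄` of the Galois action on the geometric `p`-torsion of `E ⊗ K₀`
(`WeierstrassCurve.IsTorsionGaloisRep`; all framings are conjugate) is upper triangular — `E` admits a
`K₀`-rational `p`-isogeny.  At `p = 5` this is VERBATIM the conclusion of clause (ii) of `Box2022_theorem1_3`. -/
def BorelAt (K₀ : Type) [Field K₀] [NumberField K₀] (E : WeierstrassCurve (𝓞 K₀)) (p : ℕ) : Prop :=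
  ∃ ρ : FramedGaloisRep K₀ (ZMod p) 2, (E.baseChange K₀).IsTorsionGaloisRep p ρ ∧
    ∀ σ : absoluteGaloisGroup K₀, ((ρ σ : GL (Fin 2) (ZMod p)) : Matrix (Fin 2) (Fin 2) (ZMod p)) 1 0 = 0

/-- SPLIT-CARTAN SHAPE at `3`: some framing of `E[3]` takes values in `C_s⁺(3) = ⟨diag(1,2), (0 1; 1 0)⟩`
(Box's generators, as written in `Box2022_theorem1_3` (i)). -/
def SplitCartanThree (K₀ : Type) [Field K₀] [NumberField K₀] (E : WeierstrassCurve (𝓞 K₀)) : Prop :=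
  ∃ ρ : FramedGaloisRep K₀ (ZMod 3) 2, (E.baseChange K₀).IsTorsionGaloisRep 3 ρ ∧
    ∀ σ : absoluteGaloisGroup K₀, (ρ σ : GL (Fin 2) (ZMod 3)) ∈
      Subgroup.closure ({(⟨!![1, 0; 0, 2], !![1, 0; 0, 2], by decide, by decide⟩ : GL (Fin 2) (ZMod 3)),
        (⟨!![0, 1; 1, 0], !![0, 1; 1, 0], by decide, by decide⟩ : GL (Fin 2) (ZMod 3))} :
        Set (GL (Fin 2) (ZMod 3)))

/-- `G(e7)` SHAPE at `7`: some framing of `E[7]` takes values in Box's `G(e7) = ⟨(0 5; 3 0), (5 0; 3 2)⟩ ⊂ GL₂(𝔽₇)`,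
the index-`2` subgroup of a non-split Cartan normaliser singled out by FLS 2015 (= `FLS2015.subgroupE7`). -/
def E7Seven (K₀ : Type) [Field K₀] [NumberField K₀] (E : WeierstrassCurve (𝓞 K₀)) : Prop :=
  ∃ ρ : FramedGaloisRep K₀ (ZMod 7) 2, (E.baseChange K₀).IsTorsionGaloisRep 7 ρ ∧
    ∀ σ : absoluteGaloisGroup K₀, (ρ σ : GL (Fin 2) (ZMod 7)) ∈
      Subgroup.closure ({(⟨!![0, 5; 3, 0], !![0, 5; 3, 0], by decide, by decide⟩ : GL (Fin 2) (ZMod 7)),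
        (⟨!![5, 0; 3, 2], !![3, 0; 6, 4], by decide, by decide⟩ : GL (Fin 2) (ZMod 7))} :
        Set (GL (Fin 2) (ZMod 7)))

/-- Clause (i) of `Box2022_theorem1_3` VERBATIM: some framing of `E[3]` is Borel OR `C_s⁺(3)`-valued. -/
def BorelOrSplitCartanThree (K₀ : Type) [Field K₀] [NumberField K₀] (E : WeierstrassCurve (𝓞 K₀)) : Prop :=
  ∃ ρ : FramedGaloisRep K₀ (ZMod 3) 2, (E.baseChange K₀).IsTorsionGaloisRep 3 ρ ∧
    ((∀ σ : absoluteGaloisGroup K₀, ((ρ σ : GL (Fin 2) (ZMod 3)) : Matrix (Fin 2) (Fin 2) (ZMod 3)) 1 0 = 0) ∨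
      (∀ σ : absoluteGaloisGroup K₀, (ρ σ : GL (Fin 2) (ZMod 3)) ∈
        Subgroup.closure ({(⟨!![1, 0; 0, 2], !![1, 0; 0, 2], by decide, by decide⟩ : GL (Fin 2) (ZMod 3)),
          (⟨!![0, 1; 1, 0], !![0, 1; 1, 0], by decide, by decide⟩ : GL (Fin 2) (ZMod 3))} :
          Set (GL (Fin 2) (ZMod 3)))))

/-- The conclusion of clause (iii) of `Box2022_theorem1_3` VERBATIM: some framing of `E[7]` is Borel OR `G(e7)`-valued. -/
def BorelOrE7Seven (K₀ : Type) [Field K₀] [NumberField K₀] (E : WeierstrassCurve (𝓞 K₀)) : Prop :=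
  ∃ ρ : FramedGaloisRep K₀ (ZMod 7) 2, (E.baseChange K₀).IsTorsionGaloisRep 7 ρ ∧
    ((∀ σ : absoluteGaloisGroup K₀, ((ρ σ : GL (Fin 2) (ZMod 7)) : Matrix (Fin 2) (Fin 2) (ZMod 7)) 1 0 = 0) ∨
      (∀ σ : absoluteGaloisGroup K₀, (ρ σ : GL (Fin 2) (ZMod 7)) ∈
        Subgroup.closure ({(⟨!![0, 5; 3, 0], !![0, 5; 3, 0], by decide, by decide⟩ : GL (Fin 2) (ZMod 7)),
          (⟨!![5, 0; 3, 2], !![3, 0; 6, 4], by decide, by decide⟩ : GL (Fin 2) (ZMod 7))} :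
          Set (GL (Fin 2) (ZMod 7)))))

/-- BOX SHAPE of `E / K₀`: the conclusion of `Box2022_theorem1_3` at `(K₀, E)` VERBATIM — clause (i), clause (ii)
(conditional on `√5 ∉ K₀`), clause (iii) (conditional on `ℚ(ζ₇)⁺ ⊄ K₀`). -/
def BoxShape (K₀ : Type) [Field K₀] [NumberField K₀] (E : WeierstrassCurve (𝓞 K₀)) : Prop :=
  BorelOrSplitCartanThree K₀ E ∧ (¬ IsSquare (5 : K₀) → BorelAt K₀ E 5) ∧
    ((∀ x : K₀, x ^ 3 + x ^ 2 - 2 * x - 1 ≠ 0) → BorelOrE7Seven K₀ E)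

/-! ## §2 The declared residual CORE′ and the three sectors -/

/-- CORE′ — THE DECLARED RESIDUAL of this node (IDEA-NEEDED; no print): CORE ∩ BoxShape.  An integral `E` over an
unanchored totally real `K₀` (degree `≥ 6`), `[ℚ(j):ℚ]` in the residual range, off the Allen locus, off g30's three
doors, AND of Box shape — Borel-or-`C_s⁺` at `3`; a `K₀`-rational `5`-isogeny unless `√5 ∈ K₀`; Borel-or-`G(e7)` at
`7` unless `ℚ(ζ₇)⁺ ⊆ K₀` — is modular. -/
def RefinedCore : Prop :=
  ∀ (K₀ : Type) [Field K₀] [NumberField K₀], UnanchoredBox K₀ →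
    ∀ E : WeierstrassCurve (𝓞 K₀), E.Δ ≠ 0 → InResidualRange K₀ E → ¬ AllenLocus K₀ E → OffDoors K₀ E →
      BoxShape K₀ E → IsModularEllipticCurve K₀ E

/-- T5 — THE THORNE SECTOR (E-level, every totally real field): `√5 ∉ K₀` and `E[5]` has NO Borel framing (no
`K₀`-rational `5`-isogeny) ⇒ `E` modular.  [ref: Thorne2016, Thm. 7.6] [ref: Box2022, Thm. 1.3 (ii)] -/
def ThorneFiveSector : Prop :=
  ∀ (K₀ : Type) [Field K₀] [NumberField K₀], IsTotallyReal K₀ →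
    ∀ E : WeierstrassCurve (𝓞 K₀), E.Δ ≠ 0 → ¬ IsSquare (5 : K₀) → ¬ BorelAt K₀ E 5 → IsModularEllipticCurve K₀ E

/-- K7 — THE KALYANSWAMY SECTOR (E-level, every totally real field): `ℚ(ζ₇)⁺ ⊄ K₀` and `E[7]` has NO framing in
`B(7)` or `G(e7)` ⇒ `E` modular.  [ref: Kalyanswamy2018, Thm. 1.2] [ref: FreitasLeHungSiksek2015, Thm. 4, Prop. 9.1 (c)]
[ref: Box2022, Thm. 1.3 (iii)] -/
def KalyanswamySevenSector : Prop :=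
  ∀ (K₀ : Type) [Field K₀] [NumberField K₀], IsTotallyReal K₀ →
    ∀ E : WeierstrassCurve (𝓞 K₀), E.Δ ≠ 0 → (∀ x : K₀, x ^ 3 + x ^ 2 - 2 * x - 1 ≠ 0) → ¬ BorelOrE7Seven K₀ E →
      IsModularEllipticCurve K₀ E

/-- C3 — THE MOD-3 SECTOR (E-level, every totally real field): `E[3]` has NO framing in `B(3)` or `C_s⁺(3)` ⇒ `E`
modular (FLS 2015 Thm. 3 + Prop. 9.1 (a); = clause (i)).  [ref: FreitasLeHungSiksek2015, Thm. 3, Prop. 9.1 (a)] -/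
def CartanThreeSector : Prop :=
  ∀ (K₀ : Type) [Field K₀] [NumberField K₀], IsTotallyReal K₀ →
    ∀ E : WeierstrassCurve (𝓞 K₀), E.Δ ≠ 0 → ¬ BorelOrSplitCartanThree K₀ E → IsModularEllipticCurve K₀ E

/-! ## §3 The cells of CORE′ cut by the dial `K₀ ∩ ℚ(ζ₅)⁺`, `K₀ ∩ ℚ(ζ₇)⁺` -/

/-- CELL D — LINEARLY DISJOINT FIELDS (`√5 ∉ K₀` and `ℚ(ζ₇)⁺ ⊄ K₀`; contains every `K₀` of degree prime to `6`):
the residual curve carries a `K₀`-rational `5`-isogeny, a `B(3)`-or-`C_s⁺(3)` structure and a `B(7)`-or-`G(e7)`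
structure (a `K₀`-point of one of FOUR level-`105` modular curves) — and is to be shown modular.  IDEA-NEEDED. -/
def DisjointFieldCell : Prop :=
  ∀ (K₀ : Type) [Field K₀] [NumberField K₀], UnanchoredBox K₀ → ¬ IsSquare (5 : K₀) →
    (∀ x : K₀, x ^ 3 + x ^ 2 - 2 * x - 1 ≠ 0) →
    ∀ E : WeierstrassCurve (𝓞 K₀), E.Δ ≠ 0 → InResidualRange K₀ E → ¬ AllenLocus K₀ E → OffDoors K₀ E →
      BorelOrSplitCartanThree K₀ E → BorelAt K₀ E 5 → BorelOrE7Seven K₀ E → IsModularEllipticCurve K₀ E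

/-- CELL T — ENTANGLED FIELDS (`√5 ∈ K₀` or `ℚ(ζ₇)⁺ ⊆ K₀`; forces `2 ∣ [K₀:ℚ]` or `3 ∣ [K₀:ℚ]`): CORE′ on these
fields (Box shape = clause (i) and whichever of (ii)/(iii) survives).  IDEA-NEEDED. -/
def EntangledFieldCell : Prop :=
  ∀ (K₀ : Type) [Field K₀] [NumberField K₀], UnanchoredBox K₀ →
    (IsSquare (5 : K₀) ∨ ∃ x : K₀, x ^ 3 + x ^ 2 - 2 * x - 1 = 0) →
    ∀ E : WeierstrassCurve (𝓞 K₀), E.Δ ≠ 0 → InResidualRange K₀ E → ¬ AllenLocus K₀ E → OffDoors K₀ E →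
      BoxShape K₀ E → IsModularEllipticCurve K₀ E

/-- The bundled hypothesis "`(K₀, E)` lies on CELL D" (field disjoint from `ℚ(ζ₅)⁺`, `ℚ(ζ₇)⁺`; `E` in CORE's regime). -/
def OnDisjointCell (K₀ : Type) [Field K₀] [NumberField K₀] (E : WeierstrassCurve (𝓞 K₀)) : Prop :=
  UnanchoredBox K₀ ∧ ¬ IsSquare (5 : K₀) ∧ (∀ x : K₀, x ^ 3 + x ^ 2 - 2 * x - 1 ≠ 0) ∧
    E.Δ ≠ 0 ∧ InResidualRange K₀ E ∧ ¬ AllenLocus K₀ E ∧ OffDoors K₀ E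

/-- LEVEL CELL `(b3, b5, b7)` = `K₀`-points of `X₀(105)` on CELL D: rational `3`-, `5`- and `7`-isogenies. -/
def CellB3B5B7 : Prop :=
  ∀ (K₀ : Type) [Field K₀] [NumberField K₀] (E : WeierstrassCurve (𝓞 K₀)), OnDisjointCell K₀ E →
    BorelAt K₀ E 3 → BorelAt K₀ E 5 → BorelAt K₀ E 7 → IsModularEllipticCurve K₀ E

/-- LEVEL CELL `(s3, b5, b7)` = `K₀`-points of `X(s3, b5, b7)` on CELL D. -/
def CellS3B5B7 : Prop :=
  ∀ (K₀ : Type) [Field K₀] [NumberField K₀] (E : WeierstrassCurve (𝓞 K₀)), OnDisjointCell K₀ E →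
    SplitCartanThree K₀ E → BorelAt K₀ E 5 → BorelAt K₀ E 7 → IsModularEllipticCurve K₀ E

/-- LEVEL CELL `(b3, b5, e7)` = `K₀`-points of `X(b3, b5, e7)` on CELL D. -/
def CellB3B5E7 : Prop :=
  ∀ (K₀ : Type) [Field K₀] [NumberField K₀] (E : WeierstrassCurve (𝓞 K₀)), OnDisjointCell K₀ E →
    BorelAt K₀ E 3 → BorelAt K₀ E 5 → E7Seven K₀ E → IsModularEllipticCurve K₀ E

/-- LEVEL CELL `(s3, b5, e7)` = `K₀`-points of `X(s3, b5, e7)` on CELL D. -/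
def CellS3B5E7 : Prop :=
  ∀ (K₀ : Type) [Field K₀] [NumberField K₀] (E : WeierstrassCurve (𝓞 K₀)), OnDisjointCell K₀ E →
    SplitCartanThree K₀ E → BorelAt K₀ E 5 → E7Seven K₀ E → IsModularEllipticCurve K₀ E

end Summit.Langlands.Langlands.Theorems.RealCyclotomicDoorSplit
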